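import Summits.RiemannHypothesis.RiemannHypothesis.Theses.WeilComb

/-!
# Sketch — crux idea `delsarte-lag-witness` (crux `CombSubcritical`, stmt-RiemannHypothesis-1025)

First-lemma signatures for the Delsarte/Bochner dual-witness line. Everything is stated over
Mathlib + the route file; nothing here is proved except the trivial `lagCost_symm`-free facts.
-/

noncomputable section
open scoped BigOperators
open Finset Real

namespace Summit.RiemannHypothesis.RiemannHypothesis.Cruxes.CombSubcritical.DelsarteLagWitness

/-- The symmetric von Mangoldt–Helson lag entry: `Λ(n) n^{-1/2}` if `m/m'` or `m'/m` is the
integer `n ≥ 2`, else `0`.  It depends on the pair only through the ratio `m/m'`. -/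
def helsonEntry (m m' : ℕ) : ℝ :=
  if m' ∣ m ∧ m ≠ m' then (ArithmeticFunction.vonMangoldt (m / m') : ℝ) / Real.sqrt ((m / m' : ℕ) : ℝ)
  else if m ∣ m' ∧ m ≠ m' then (ArithmeticFunction.vonMangoldt (m' / m) : ℝ) / Real.sqrt ((m' / m : ℕ) : ℝ)
  else 0

/-- The full LAG COST at an off-diagonal pair: Helson entry + beam `b/|log m − log m'|`
+ polar shadow `p·cosh((log m − log m')/2)`.  All three are EVEN functions of the lag
`x = log m − log m'` (this is what makes a Fourier-side dual certificate natural). -/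
def lagCost (b p : ℝ) (m m' : ℕ) : ℝ :=
  helsonEntry m m' + b / |Real.log m - Real.log m'| + p * Real.cosh ((Real.log m - Real.log m') / 2)

/-- `f : ℝ → ℝ` is POSITIVE-DEFINITE ON ℝ (real form): every finite Gram matrix `[f(x_i − x_j)]` is
positive semidefinite.  This is the TRANSLATION-INVARIANT witness class (Bochner: `f` = cosine transform of
a finite positive measure); it is checkable without reference to the configuration `log 1, …, log M` —
which is the whole point: the configuration-restricted class would contain `λ_max·δ₀ − K` trivially. -/
def IsPosDef (f : ℝ → ℝ) : Prop :=
  ∀ (s : Finset ℕ) (x c : ℕ → ℝ), 0 ≤ ∑ i ∈ s, ∑ j ∈ s, c i * c j * f (x i - x j)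

/-- Gram positivity of `f` on the specific nodes `log 1, …, log M` (what weak duality consumes). -/
def GramPSDOnLogs (M : ℕ) (f : ℝ → ℝ) : Prop :=
  ∀ c : ℕ → ℝ, 0 ≤ ∑ m ∈ Icc 1 M, ∑ m' ∈ Icc 1 M, c m * c m' * f (Real.log m - Real.log m')

/-- Specialisation: positive-definite on ℝ ⇒ Gram-PSD on the log nodes (take the configuration
`s = Icc 1 M`, `x_i = log i`). PROVED below (`posDefRestrict_holds`). -/
def PosDefRestrict : Prop :=
  ∀ (f : ℝ → ℝ) (M : ℕ), IsPosDef f → GramPSDOnLogs M f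

theorem posDefRestrict_holds : PosDefRestrict :=
  fun f M hf c => hf (Icc 1 M) (fun i => Real.log i) c

/-- `f` is a LAG WITNESS at level `lam` for size `M` and coefficients `(b, p)`: (i) `f` is positive-definite
on ℝ, (ii) `f 0 ≤ lam`, (iii) `f ≤ −lagCost` at every off-diagonal lag of `{1..M}`. -/
def IsLagWitness (M : ℕ) (b p lam : ℝ) (f : ℝ → ℝ) : Prop :=
  IsPosDef f ∧ f 0 ≤ lam ∧
  ∀ m ∈ Icc 1 M, ∀ m' ∈ Icc 1 M, m ≠ m' → f (Real.log m - Real.log m') ≤ -lagCost b p m m'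

/-- Bochner for the LP dictionary: `f(x) = Σ_k B_k cos(ω_k x)` with `B_k ≥ 0` (and, more generally,
Gabor packets `B_k e^{-x²/2s_k²} cos(ω_k x)`) has positive semidefinite Gram matrices on every finite
node set — `Σ_{m,m'} c_m c_{m'} cos(ω(x_m − x_{m'})) = (Σ c_m cos ωx_m)² + (Σ c_m sin ωx_m)² ≥ 0`. -/
def CosineDictionaryPSD : Prop :=
  ∀ (K : ℕ) (B ω : ℕ → ℝ), (∀ k, 0 ≤ B k) → ∀ (M : ℕ) (c : ℕ → ℝ),
    0 ≤ ∑ m ∈ Icc 1 M, ∑ m' ∈ Icc 1 M, c m * c m' *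
      ∑ k ∈ range K, B k * Real.cos (ω k * (Real.log m - Real.log m'))

/-- FIRST LEMMA (weak duality, five lines on paper): a lag witness at level `lam` certifies the
joint lag-kernel bound — Helson + beam + polar shadow — for ALL nonnegative coefficient vectors at
once: expand `0 ≤ Σ a_m a_{m'} f(x_{mm'})`, bound the diagonal by `f 0 ≤ lam` and each
off-diagonal term by `a_m a_{m'} ≥ 0` and `f ≤ −lagCost`. -/
def CoreOfLagWitness : Prop :=
  PosDefRestrict →
  ∀ (M : ℕ) (b p lam : ℝ) (f : ℝ → ℝ), IsLagWitness M b p lam f →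
    ∀ a : ℕ → ℝ, (∀ m, 0 ≤ a m) →
      ∑ m ∈ Icc 1 M, ∑ m' ∈ (Icc 1 M).erase m, a m * a m' * lagCost b p m m'
        ≤ lam * ∑ m ∈ Icc 1 M, a m ^ 2


/-- Weak duality, PROVED (the composition step of the line is not a bet). -/
theorem coreOfLagWitness_holds : CoreOfLagWitness := by
  intro hrestrict M b p lam f hf a ha
  obtain ⟨hpd, h0, hoff⟩ := hf
  have key := hrestrict f M hpd a
  have hsplit : ∀ m ∈ Icc 1 M,
      ∑ m' ∈ Icc 1 M, a m * a m' * f (Real.log m - Real.log m')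
        = a m * a m * f 0 + ∑ m' ∈ (Icc 1 M).erase m, a m * a m' * f (Real.log m - Real.log m') := by
    intro m hm
    rw [← Finset.add_sum_erase _ _ hm, sub_self]
  have hoffsum : ∀ m ∈ Icc 1 M,
      ∑ m' ∈ (Icc 1 M).erase m, a m * a m' * f (Real.log m - Real.log m')
        ≤ -∑ m' ∈ (Icc 1 M).erase m, a m * a m' * lagCost b p m m' := by
    intro m hm
    rw [← Finset.sum_neg_distrib]
    apply Finset.sum_le_sum
    intro m' hm'
    have hne : m ≠ m' := fun h => (Finset.ne_of_mem_erase hm') h.symm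
    have hm'S : m' ∈ Icc 1 M := Finset.mem_of_mem_erase hm'
    have hfle := hoff m hm m' hm'S hne
    have hprod : 0 ≤ a m * a m' := mul_nonneg (ha m) (ha m')
    calc a m * a m' * f (Real.log m - Real.log m')
        ≤ a m * a m' * (-lagCost b p m m') := mul_le_mul_of_nonneg_left hfle hprod
      _ = -(a m * a m' * lagCost b p m m') := by ring
  have h1 : ∑ m ∈ Icc 1 M, ∑ m' ∈ Icc 1 M, a m * a m' * f (Real.log m - Real.log m')
      ≤ ∑ m ∈ Icc 1 M, (a m * a m * f 0 - ∑ m' ∈ (Icc 1 M).erase m, a m * a m' * lagCost b p m m') := by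
    apply Finset.sum_le_sum
    intro m hm
    rw [hsplit m hm]
    linarith [hoffsum m hm]
  have h2 : ∑ m ∈ Icc 1 M, (a m * a m * f 0 - ∑ m' ∈ (Icc 1 M).erase m, a m * a m' * lagCost b p m m')
      = f 0 * ∑ m ∈ Icc 1 M, a m ^ 2
        - ∑ m ∈ Icc 1 M, ∑ m' ∈ (Icc 1 M).erase m, a m * a m' * lagCost b p m m' := by
    rw [Finset.sum_sub_distrib, Finset.mul_sum]
    congr 1
    exact Finset.sum_congr rfl (fun m _ => by ring)
  have hsq : 0 ≤ ∑ m ∈ Icc 1 M, a m ^ 2 := Finset.sum_nonneg (fun m _ => sq_nonneg (a m))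
  have h3 : f 0 * ∑ m ∈ Icc 1 M, a m ^ 2 ≤ lam * ∑ m ∈ Icc 1 M, a m ^ 2 :=
    mul_le_mul_of_nonneg_right h0 hsq
  linarith [key, h1, h2, h3]

/-- TRANSFER `C⁺` (the bet): for some absolute `C, b₀ > 0`, every `M ≥ 1` and all beam/polar
coefficients `0 ≤ b, p ≤ b₀/M` admit a lag witness at level `log M + C`.  By `CoreOfLagWitness`
this gives `⟨S_M|a|,|a|⟩ + (b₀/M)(⟨B_M|a|,|a|⟩ + A₋A₊-shadow) ≤ (log M + C)‖a‖²`, i.e. the arithmetic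
core of the picked line (`stub_core`'s conclusion with `c₀ ≍ b₀`), hence — with the landed analytic
stubs — `WeilComb.CombSubcritical`. -/
def LagWitnessFamily : Prop :=
  ∃ C b₀ : ℝ, 0 < b₀ ∧ ∀ M : ℕ, 1 ≤ M → ∀ b p : ℝ, 0 ≤ b → b ≤ b₀ / M → 0 ≤ p → p ≤ b₀ / M →
    ∃ f : ℝ → ℝ, IsLagWitness M b p (Real.log M + C) f

/-- Target shape of the line (composition to be kernel-checked at crux-plan): witnesses + weak duality
+ the analytic reduction already built in `Lines/helson-dirichlet-slack.lean` give the crux. -/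
def LineShape : Prop :=
  LagWitnessFamily → CoreOfLagWitness →
    Summit.RiemannHypothesis.RiemannHypothesis.Theses.WeilComb.CombSubcritical

/-- TOY TIGHTNESS (M = 2): the single cosine `f(x) = (Λ 2/√2)·cos(πx/log 2)` is a lag witness at the
true level `λ_max = Λ(2)/√2` (beam and polar switched off). -/
def ToyWitnessTwo : Prop :=
  IsLagWitness 2 0 0 ((ArithmeticFunction.vonMangoldt 2 : ℝ) / Real.sqrt 2)
    (fun x : ℝ => (ArithmeticFunction.vonMangoldt 2 : ℝ) / Real.sqrt 2 * Real.cos (Real.pi * x / Real.log 2))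

/-- A single cosine `x ↦ B cos(ω x)` with `B ≥ 0` is positive-definite on ℝ
(`Σ c_i c_j cos(ω(x_i − x_j)) = (Σ c_i cos ωx_i)² + (Σ c_i sin ωx_i)²`). PROVED. -/
theorem isPosDef_cos (B ω : ℝ) (hB : 0 ≤ B) : IsPosDef (fun x => B * Real.cos (ω * x)) := by
  intro s x c
  have key : ∑ i ∈ s, ∑ j ∈ s, c i * c j * (B * Real.cos (ω * (x i - x j)))
      = B * ((∑ i ∈ s, c i * Real.cos (ω * x i)) ^ 2 + (∑ i ∈ s, c i * Real.sin (ω * x i)) ^ 2) := by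
    have e : ∀ i j, c i * c j * (B * Real.cos (ω * (x i - x j)))
        = B * (c i * Real.cos (ω * x i) * (c j * Real.cos (ω * x j))
            + c i * Real.sin (ω * x i) * (c j * Real.sin (ω * x j))) := by
      intro i j
      rw [mul_sub, Real.cos_sub]
      ring
    simp_rw [e]
    rw [sq, sq, Finset.sum_mul_sum, Finset.sum_mul_sum, ← Finset.sum_add_distrib, Finset.mul_sum]
    congr 1
    funext i
    rw [← Finset.sum_add_distrib, Finset.mul_sum]
  rw [key]
  positivity

/-- Nonnegative combinations of positive-definite functions are positive-definite (so every LP-dictionary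
output `Σ_k B_k cos(ω_k x)`, `B_k ≥ 0`, is an admissible witness). PROVED. -/
theorem isPosDef_add {f g : ℝ → ℝ} (hf : IsPosDef f) (hg : IsPosDef g) : IsPosDef (fun x => f x + g x) := by
  intro s x c
  have e : ∑ i ∈ s, ∑ j ∈ s, c i * c j * (f (x i - x j) + g (x i - x j))
      = (∑ i ∈ s, ∑ j ∈ s, c i * c j * f (x i - x j)) + ∑ i ∈ s, ∑ j ∈ s, c i * c j * g (x i - x j) := by
    rw [← Finset.sum_add_distrib]
    refine Finset.sum_congr rfl (fun i _ => ?_)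
    rw [← Finset.sum_add_distrib]
    refine Finset.sum_congr rfl (fun j _ => ?_)
    ring
  rw [e]
  exact add_nonneg (hf s x c) (hg s x c)

/-- The M = 2 toy witness is an admissible lag witness at the true level Λ(2)/√2 — modulo the two numeric
facts `cos π = −1` at the lag `log 2` and the value at `0`; stated, the PD part is `isPosDef_cos`. -/
example : IsPosDef (fun x : ℝ => (ArithmeticFunction.vonMangoldt 2 : ℝ) / Real.sqrt 2 * Real.cos (Real.pi / Real.log 2 * x)) :=
  isPosDef_cos _ _ (div_nonneg ArithmeticFunction.vonMangoldt_nonneg (Real.sqrt_nonneg _))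

end Summit.RiemannHypothesis.RiemannHypothesis.Cruxes.CombSubcritical.DelsarteLagWitness

end
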